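import Summits.Ventures.PercRepro.C025ProfileStagedLine3Absorb

/-!
# SESSION 4 (continued) — LEMMA 3: THE TWO-COLOOP SETS `Q ∪ {a, x}` (night-3 g12; proofs/NIGHT3-G12-LINE3.md §2)
`S = Q ∪ {a, x}` with `Q` a full `3`-point line (rank `2`, `cl Q = Q`), `a, x ∉ Q`, `ρ(S) = 4`, in a simple matroid of rank `≥ 5`.
The points of `Q` are not coloops (`rkN_erase_eq_four_of_mem_line`), so the `Ls`-pairs are among `(y, x)` (demander `(Q∖y) ∪ a`) and
`(y, a)` (demander `(Q∖y) ∪ x`), `y ∈ Q` (`lsPairs_subset_line_product`), and `rigid S ≤ #dcol S + 3 c_a + 3 c_x` for any bounds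
`c_a`, `c_x` of the two kinds of `Ls`-terms (`rigid_two_coloops_le`).
-/
open scoped Matroid
namespace PercRepro
open Set Finset ThmH
namespace Staged
variable {α : Type} [DecidableEq α] {M : Matroid α} [M.Finite]

omit [DecidableEq α] in
/-- `clF` is idempotent. -/
theorem clF_clF (X : Finset α) : clF M (clF M X) = clF M X := by
  apply Finset.coe_inj.mp
  rw [coe_clF, coe_clF, M.closure_closure]

omit [DecidableEq α] in
/-- Points of the closure do not raise the rank: `rkN X' ≤ rkN X` for `X' ⊆ clF X`. -/
theorem rkN_le_of_subset_clF {X X' : Finset α} (h : X' ⊆ clF M X) : rkN M X' ≤ rkN M X := by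
  calc rkN M X' ≤ rkN M (clF M X) := rkN_mono h
    _ = rkN M X := rkN_clF X

/-- `rkN (insert e X) ≤ rkN X + 1`. -/
theorem rkN_insert_le {X : Finset α} (e : α) : rkN M (insert e X) ≤ rkN M X + 1 := by
  have h := M.eRk_insert_le_add_one e (X : Set α)
  rw [← Finset.coe_insert, ← coe_rkN, ← coe_rkN] at h
  exact_mod_cast h

omit [DecidableEq α] in
/-- A full `3`-point line is closed when the rank-`≤ 2` sets have `≤ 3` points. -/
theorem clF_eq_self_of_line (h3line : ∀ X ⊆ gr M, rkN M X ≤ 2 → X.card ≤ 3) {Q : Finset α} (hQg : Q ⊆ gr M)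
    (hQ2 : rkN M Q = 2) (hQc : Q.card = 3) : clF M Q = Q := by
  symm
  apply Finset.eq_of_subset_of_card_le (subset_clF_self hQg)
  rw [hQc]
  exact h3line _ (clF_subset_gr Q) (by rw [rkN_clF, hQ2])

/-- In a simple matroid (`hsimple`), removing a point of the line `Q` from `S = Q ∪ {a, x}` keeps the rank `4`. -/
theorem rkN_erase_eq_four_of_mem_line (hsimple : ∀ X ⊆ gr M, X.card = 2 → rkN M X = 2)
    {Q : Finset α} {a x : α} (hQg : Q ⊆ gr M) (hag : a ∈ gr M) (hxg : x ∈ gr M) (hQ2 : rkN M Q = 2) (hQc : Q.card = 3)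
    (haQ : a ∉ Q) (hxQ : x ∉ Q) (hS4 : rkN M (insert a (insert x Q)) = 4) {z : α} (hz : z ∈ Q) :
    rkN M ((insert a (insert x Q)).erase z) = 4 := by
  have hza : a ≠ z := fun h => haQ (h ▸ hz)
  have hzx : x ≠ z := fun h => hxQ (h ▸ hz)
  have hE : (insert a (insert x Q)).erase z = insert a (insert x (Q.erase z)) := by
    rw [Finset.erase_insert_of_ne hza, Finset.erase_insert_of_ne hzx]
  have hQz2 : rkN M (Q.erase z) = 2 := by
    apply hsimple _ ((Finset.erase_subset _ _).trans hQg)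
    rw [Finset.card_erase_of_mem hz, hQc]
  have hcl : clF M (Q.erase z) = clF M Q :=
    clF_eq_clF_of_subset_of_rkN_le (Finset.erase_subset z Q) (by rw [hQz2, hQ2])
  have hTg : insert a (insert x (Q.erase z)) ⊆ gr M :=
    Finset.insert_subset hag (Finset.insert_subset hxg ((Finset.erase_subset _ _).trans hQg))
  have hsub : insert a (insert x Q) ⊆ clF M (insert a (insert x (Q.erase z))) := by
    intro w hw
    rw [Finset.mem_insert, Finset.mem_insert] at hw
    rcases hw with rfl | rfl | hwQ
    · exact subset_clF_self hTg (Finset.mem_insert_self _ _)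
    · exact subset_clF_self hTg (Finset.mem_insert_of_mem (Finset.mem_insert_self _ _))
    · have h1 : w ∈ clF M (Q.erase z) := by rw [hcl]; exact subset_clF_self hQg hwQ
      exact clF_mono ((Finset.subset_insert _ _).trans (Finset.subset_insert _ _)) h1
  rw [hE]
  apply le_antisymm
  · rw [← hS4]
    exact rkN_mono (Finset.insert_subset_insert _ (Finset.insert_subset_insert _ (Finset.erase_subset _ _)))
  · rw [← hS4]; exact rkN_le_of_subset_clF hsub

/-- The coloops of `S = Q ∪ {a, x}` are among `a, x`. -/
theorem coloops_subset_pair (hsimple : ∀ X ⊆ gr M, X.card = 2 → rkN M X = 2)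
    {Q : Finset α} {a x : α} (hQg : Q ⊆ gr M) (hag : a ∈ gr M) (hxg : x ∈ gr M) (hQ2 : rkN M Q = 2) (hQc : Q.card = 3)
    (haQ : a ∉ Q) (hxQ : x ∉ Q) (hS4 : rkN M (insert a (insert x Q)) = 4) :
    ((insert a (insert x Q)).filter (fun t => rkN M ((insert a (insert x Q)).erase t) ≤ 3)) ⊆ ({a, x} : Finset α) := by
  intro z hz
  rw [Finset.mem_filter, Finset.mem_insert, Finset.mem_insert] at hz
  rw [Finset.mem_insert, Finset.mem_singleton]
  rcases hz.1 with h | h | h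
  · exact Or.inl h
  · exact Or.inr h
  · exfalso
    have := rkN_erase_eq_four_of_mem_line hsimple hQg hag hxg hQ2 hQc haQ hxQ hS4 h
    omega

/-- `(S ∖ y) ∖ x = (Q ∖ y) ∪ {a}` and `(S ∖ y) ∖ a = (Q ∖ y) ∪ {x}` for `y ∈ Q`. -/
theorem erase_erase_line {Q : Finset α} {a x y : α} (haQ : a ∉ Q) (hxQ : x ∉ Q) (hax : a ≠ x) (hy : y ∈ Q) :
    ((insert a (insert x Q)).erase y).erase x = insert a (Q.erase y) ∧
    ((insert a (insert x Q)).erase y).erase a = insert x (Q.erase y) := by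
  have hya : a ≠ y := fun h => haQ (h ▸ hy)
  have hyx : x ≠ y := fun h => hxQ (h ▸ hy)
  have hxQy : x ∉ Q.erase y := fun h => hxQ (Finset.mem_of_mem_erase h)
  have haQy : a ∉ Q.erase y := fun h => haQ (Finset.mem_of_mem_erase h)
  have haxQ : a ∉ insert x (Q.erase y) := by
    rw [Finset.mem_insert]; push Not; exact ⟨hax, haQy⟩
  constructor
  · rw [Finset.erase_insert_of_ne hya, Finset.erase_insert_of_ne hyx, Finset.erase_insert_of_ne hax,
      Finset.erase_insert hxQy]
  · rw [Finset.erase_insert_of_ne hya, Finset.erase_insert_of_ne hyx, Finset.erase_insert haxQ]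

/-- The `Ls`-pairs of `S = Q ∪ {a, x}` are among `Q × {a, x}`. -/
theorem lsPairs_subset_line_product (hsimple : ∀ X ⊆ gr M, X.card = 2 → rkN M X = 2)
    {Q : Finset α} {a x : α} (hQg : Q ⊆ gr M) (hag : a ∈ gr M) (hxg : x ∈ gr M) (hQ2 : rkN M Q = 2) (hQc : Q.card = 3)
    (haQ : a ∉ Q) (hxQ : x ∉ Q) (hax : a ≠ x) (hS4 : rkN M (insert a (insert x Q)) = 4) :
    lsPairs M (insert a (insert x Q)) ⊆ Q ×ˢ ({a, x} : Finset α) := by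
  intro yx hyx
  have hSg : insert a (insert x Q) ⊆ gr M := Finset.insert_subset hag (Finset.insert_subset hxg hQg)
  have hp := lsPairs_subset_product hSg hyx
  rw [Finset.mem_product] at hp ⊢
  have hcol := coloops_subset_pair hsimple hQg hag hxg hQ2 hQc haQ hxQ hS4 hp.2
  refine ⟨?_, hcol⟩
  have h := mem_lsPairs.mp hyx
  obtain ⟨⟨hy, _⟩, hne, h3, _, _, _⟩ := h
  rw [Finset.mem_insert, Finset.mem_insert] at hy
  rw [Finset.mem_insert, Finset.mem_singleton] at hcol
  by_contra hyQ
  have hxaQ : x ∉ insert a Q := by rw [Finset.mem_insert]; push Not; exact ⟨fun h => hax h.symm, hxQ⟩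
  have haxQ : a ∉ insert x Q := by rw [Finset.mem_insert]; push Not; exact ⟨hax, haQ⟩
  rcases hy with h1 | h1 | h1
  · -- y = a, so x' = x and the demander would be Q
    rcases hcol with h2 | h2
    · exact hne (h1.trans h2.symm)
    · rw [h1, h2, Finset.erase_insert haxQ, Finset.erase_insert hxQ] at h3
      omega
  · rcases hcol with h2 | h2
    · rw [h1, h2, Finset.erase_insert_of_ne hax, Finset.erase_insert hxQ, Finset.erase_insert haQ] at h3
      omega
    · exact hne (h1.trans h2.symm)
  · exact hyQ h1

/-- **The two-coloop bound**: `rigid S ≤ #dcol S + 3 c_a + 3 c_x` when the a-side `Ls`-terms are `≤ c_a` and the x-side ones `≤ c_x`. -/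
theorem rigid_two_coloops_le (hsimple : ∀ X ⊆ gr M, X.card = 2 → rkN M X = 2)
    {Q : Finset α} {a x : α} (hQg : Q ⊆ gr M) (hag : a ∈ gr M) (hxg : x ∈ gr M) (hQ2 : rkN M Q = 2) (hQc : Q.card = 3)
    (haQ : a ∉ Q) (hxQ : x ∉ Q) (hax : a ≠ x) (hS4 : rkN M (insert a (insert x Q)) = 4) {ca cx : ℚ}
    (hca0 : 0 ≤ ca) (hcx0 : 0 ≤ cx)
    (hca : ∀ y ∈ Q, ovf M (insert a (Q.erase y)) x / ((inner M (insert a (Q.erase y))).card : ℚ) ≤ ca)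
    (hcx : ∀ y ∈ Q, ovf M (insert x (Q.erase y)) a / ((inner M (insert x (Q.erase y))).card : ℚ) ≤ cx) :
    rigid M (insert a (insert x Q)) ≤ ((dcol M (insert a (insert x Q))).card : ℚ) + 3 * ca + 3 * cx := by
  have hL := lsPairs_subset_line_product hsimple hQg hag hxg hQ2 hQc haQ hxQ hax hS4
  have h0 := rigid_le_card_dcol_add (M := M) (S := insert a (insert x Q))
  -- the pointwise bound g
  have hterm : ∀ yx ∈ lsPairs M (insert a (insert x Q)),
      ovf M (((insert a (insert x Q)).erase yx.1).erase yx.2) yx.2 /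
        ((inner M (((insert a (insert x Q)).erase yx.1).erase yx.2)).card : ℚ) ≤
      (if yx.2 = x then ca else cx) := by
    intro yx hyx
    have hp := hL hyx
    rw [Finset.mem_product, Finset.mem_insert, Finset.mem_singleton] at hp
    obtain ⟨hy, hx2⟩ := hp
    obtain ⟨hEa, hEx⟩ := erase_erase_line haQ hxQ hax hy
    rcases hx2 with h2 | h2
    · rw [h2, if_neg (fun h => hax h), hEx]; exact hcx yx.1 hy
    · rw [h2, if_pos rfl, hEa]; exact hca yx.1 hy
  have hsum : ∑ yx ∈ lsPairs M (insert a (insert x Q)),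
      ovf M (((insert a (insert x Q)).erase yx.1).erase yx.2) yx.2 /
        ((inner M (((insert a (insert x Q)).erase yx.1).erase yx.2)).card : ℚ) ≤ 3 * ca + 3 * cx := by
    calc _ ≤ ∑ yx ∈ lsPairs M (insert a (insert x Q)), (if yx.2 = x then ca else cx) :=
          Finset.sum_le_sum hterm
      _ ≤ ∑ yx ∈ Q ×ˢ ({a, x} : Finset α), (if yx.2 = x then ca else cx) := by
          apply Finset.sum_le_sum_of_subset_of_nonneg hL
          intro yx _ _
          split_ifs <;> assumption
      _ = 3 * ca + 3 * cx := by
          rw [Finset.sum_product]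
          simp only [Finset.sum_pair hax, if_neg hax]
          rw [Finset.sum_const, hQc, nsmul_eq_mul]
          push_cast; ring
  linarith

end Staged
end PercRepro

/-!
# SESSION 4 (continued) — LEMMA 3, THE CO-LINE CASE AND THE CONCLUSION (night-3 g12; proofs/NIGHT3-G12-LINE3.md §2)
When the plane `P_a = cl(Q ∪ a)` has exactly two outer points (`|F_a| = 2`), the matroid has rank `5`, `cl(Q ∪ x) = Q ∪ {x}`, and if
`Q ∪ x` is demanding (`a ∈ dcol S`) then every x-side demander `(Q ∖ y) ∪ x` has excess `0` (`jB_eq_zero_xside`: its inner set is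
`{y}` and `y ∈ cl(F_x)` because `P_a ∖ Q` spans `P_a`); otherwise `#dcol S ≤ 1`. Either way `rigid S ≤ 4`
(`rigid_le_four_of_outer_card_two`), and **`rigid_le_four_two_coloops_line3`** is Lemma 3.
-/
open scoped Matroid
namespace PercRepro
open Set Finset ThmH
namespace Staged
variable {α : Type} [DecidableEq α] {M : Matroid α} [M.Finite]

/-- `rkN (insert e (clF A)) = rkN (insert e A)`. -/
theorem rkN_insert_clF (e : α) (A : Finset α) : rkN M (insert e (clF M A)) = rkN M (insert e A) := by
  unfold rkN
  rw [Finset.coe_insert, Finset.coe_insert, coe_clF, M.eRk_insert_closure_eq]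

/-- `rkN (gr M) = 5` when a rank-`3` set has exactly two outer points (rank `≥ 5`). -/
theorem rkN_gr_eq_five_of_outer_card_two {A : Finset α} (hA3 : rkN M A = 3) (hR : (5 : ℕ∞) ≤ M.eRank)
    (hF : (outer M A).card = 2) : M.eRank.toNat = 5 := by
  have h1 := eRank_toNat_le_fB_add_rkN (M := M) A
  have h2 : fB M A ≤ 2 := by unfold fB; rw [← hF]; exact rkN_le_card _
  have hRtop : M.eRank ≠ ⊤ := M.eRank_ne_top_iff.2 inferInstance
  have h5 : 5 ≤ M.eRank.toNat := by
    have := ENat.toNat_le_toNat hR hRtop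
    simpa using this
  omega

/-- **The x-side excesses vanish in the co-line case**: `|F_a| = 2`, `Q ∪ x` demanding ⟹ `j = 0` for `(Q ∖ y) ∪ x`.
(`Pa`, `Fx` are the plane `cl(Q ∪ a)` and the outer set of `Q ∪ x`, passed as opaque names.) -/
theorem jB_eq_zero_xside (hsimple : ∀ X ⊆ gr M, X.card = 2 → rkN M X = 2)
    (h3line : ∀ X ⊆ gr M, rkN M X ≤ 2 → X.card ≤ 3) (hR : (5 : ℕ∞) ≤ M.eRank)
    {Q : Finset α} {a x : α} (hQg : Q ⊆ gr M) (hag : a ∈ gr M) (hxg : x ∈ gr M) (hQ2 : rkN M Q = 2) (hQc : Q.card = 3)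
    (hxQ : x ∉ Q) (hS4 : rkN M (insert a (insert x Q)) = 4)
    (hFa : (outer M (insert a Q)).card = 2) (hxd : 4 ≤ crk M (insert x Q)) {y : α} (hy : y ∈ Q)
    {Pa : Finset α} (hPa : clF M (insert a Q) = Pa) {Fx : Finset α} (hFx : gr M \ insert x Q = Fx) :
    jB M (insert x (Q.erase y)) = 0 := by
  have hclQ : clF M Q = Q := clF_eq_self_of_line h3line hQg hQ2 hQc
  have haQg : insert a Q ⊆ gr M := Finset.insert_subset hag hQg
  have hxQg : insert x Q ⊆ gr M := Finset.insert_subset hxg hQg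
  -- ranks of the two triples
  have haQ3 : rkN M (insert a Q) = 3 := by
    have h1 := rkN_insert_le (M := M) (X := Q) a
    have h2 := rkN_insert_le (M := M) (X := insert a Q) x
    rw [Finset.insert_comm, hS4] at h2
    omega
  have hxQ3 : rkN M (insert x Q) = 3 := by
    have h1 := rkN_insert_le (M := M) (X := Q) x
    have h2 := rkN_insert_le (M := M) (X := insert a Q) x
    rw [Finset.insert_comm, hS4] at h2
    have h3 := rkN_insert_le (M := M) (X := insert x Q) a
    rw [hS4] at h3
    omega
  have hPa3 : rkN M Pa = 3 := by rw [← hPa, rkN_clF, haQ3]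
  have hPag : Pa ⊆ gr M := by rw [← hPa]; exact clF_subset_gr _
  have haQPa : insert a Q ⊆ Pa := by rw [← hPa]; exact subset_clF_self haQg
  have hQPa : Q ⊆ Pa := (Finset.subset_insert _ _).trans haQPa
  have hxPa : x ∉ Pa := by
    intro hxP
    have hsub : insert a (insert x Q) ⊆ Pa := by
      rw [Finset.insert_comm]; exact Finset.insert_subset hxP haQPa
    have := rkN_mono (M := M) hsub
    omega
  have hx_out : x ∈ outer M (insert a Q) := by rw [mem_outer, hPa]; exact ⟨hxg, hxPa⟩
  have hout_eq : outer M (insert a Q) = gr M \ Pa := by unfold outer; rw [hPa]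
  -- the rank of M is 5 and insert x Pa has rank 4
  have hgr5 : rkN M (gr M) = 5 := by rw [rkN_gr_eq]; exact rkN_gr_eq_five_of_outer_card_two haQ3 hR hFa
  have hxPa4 : rkN M (insert x Pa) = 4 := by rw [← hPa, rkN_insert_clF, Finset.insert_comm, hS4]
  have hxPag : insert x Pa ⊆ gr M := Finset.insert_subset hxg hPag
  -- the other outer point is not in cl(insert x Pa)
  have hother : ∀ z ∈ gr M, z ∉ Pa → z ≠ x → z ∉ clF M (insert x Pa) := by
    intro z hzg hzPa hzx hzcl
    have hcover : gr M ⊆ clF M (insert x Pa) := by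
      intro w hw
      by_cases hwP : w ∈ Pa
      · exact subset_clF_self hxPag (Finset.mem_insert_of_mem hwP)
      · have hw_out : w ∈ gr M \ Pa := by rw [Finset.mem_sdiff]; exact ⟨hw, hwP⟩
        have hz_out : z ∈ gr M \ Pa := by rw [Finset.mem_sdiff]; exact ⟨hzg, hzPa⟩
        have hx_out' : x ∈ gr M \ Pa := by rw [Finset.mem_sdiff]; exact ⟨hxg, hxPa⟩
        have hsub : ({x, z} : Finset α) ⊆ gr M \ Pa := by
          intro t ht
          rw [Finset.mem_insert, Finset.mem_singleton] at ht
          rcases ht with rfl | rfl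
          · exact hx_out'
          · exact hz_out
        have hcard : ({x, z} : Finset α).card = 2 := Finset.card_pair (Ne.symm hzx)
        have hFa' : (gr M \ Pa).card = 2 := by rw [← hout_eq]; exact hFa
        have heq : ({x, z} : Finset α) = gr M \ Pa :=
          Finset.eq_of_subset_of_card_le hsub (by rw [hcard, hFa'])
        rw [← heq, Finset.mem_insert, Finset.mem_singleton] at hw_out
        rcases hw_out with rfl | rfl
        · exact subset_clF_self hxPag (Finset.mem_insert_self _ _)
        · exact hzcl
    have := rkN_le_of_subset_clF (M := M) hcover
    omega
  -- cl (insert x Q) = insert x Q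
  have hclxQ : clF M (insert x Q) = insert x Q := by
    refine Finset.Subset.antisymm ?_ (subset_clF_self hxQg)
    intro w hw
    have hwg : w ∈ gr M := clF_subset_gr _ hw
    by_contra hwn
    rw [Finset.mem_insert] at hwn
    push Not at hwn
    obtain ⟨hwx, hwQ⟩ := hwn
    by_cases hwP : w ∈ Pa
    · have hw_outQ : w ∈ outer M Q := by rw [mem_outer, hclQ]; exact ⟨hwg, hwQ⟩
      have hwQ3 : rkN M (insert w Q) = 3 := by rw [rkN_insert_of_mem_outer hw_outQ, hQ2]
      have hcl : clF M (insert w Q) = Pa := by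
        have h1 : clF M (insert w Q) = clF M Pa :=
          clF_eq_clF_of_subset_of_rkN_le (Finset.insert_subset hwP hQPa) (by rw [hPa3, hwQ3])
        rw [h1, ← hPa, clF_clF]
      have hx_out' : x ∈ outer M (insert w Q) := by rw [mem_outer, hcl]; exact ⟨hxg, hxPa⟩
      have h4 : rkN M (insert x (insert w Q)) = 4 := by rw [rkN_insert_of_mem_outer hx_out', hwQ3]
      have h3 : rkN M (insert w (insert x Q)) ≤ 3 := by
        rw [← hxQ3]
        exact rkN_le_of_subset_clF (Finset.insert_subset hw (subset_clF_self hxQg))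
      rw [Finset.insert_comm] at h4
      omega
    · have hsub : insert x Q ⊆ insert x Pa := Finset.insert_subset_insert x hQPa
      exact hother w hwg hwP hwx (clF_mono hsub hw)
  -- the demander B' = insert x (Q.erase y) has closure insert x Q
  have hyx : x ≠ y := fun h => hxQ (h ▸ hy)
  have hQy2 : rkN M (Q.erase y) = 2 := by
    apply hsimple _ ((Finset.erase_subset _ _).trans hQg)
    rw [Finset.card_erase_of_mem hy, hQc]
  have hB'3 : rkN M (insert x (Q.erase y)) = 3 := by
    have hx_outy : x ∈ outer M (Q.erase y) := by
      rw [outer_erase_eq_of_rkN_erase_eq (by rw [hQy2, hQ2]), mem_outer, hclQ]; exact ⟨hxg, hxQ⟩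
    rw [rkN_insert_of_mem_outer hx_outy, hQy2]
  have hB'E : insert x (Q.erase y) = (insert x Q).erase y := (Finset.erase_insert_of_ne hyx).symm
  have hclB' : clF M (insert x (Q.erase y)) = insert x Q := by
    rw [← hclxQ]
    apply clF_eq_clF_of_subset_of_rkN_le
    · rw [hB'E]; exact Finset.erase_subset _ _
    · rw [hxQ3, hB'3]
  -- the complement of B' is Fx ∪ {y}; y ∈ cl Fx
  have hFxPa : Pa \ Q ⊆ Fx := by
    intro w hw
    rw [Finset.mem_sdiff] at hw
    rw [← hFx, Finset.mem_sdiff, Finset.mem_insert]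
    refine ⟨hPag hw.1, ?_⟩
    push Not
    exact ⟨fun h => hxPa (h ▸ hw.1), hw.2⟩
  have hFxsub : Fx ⊆ (Pa \ Q) ∪ (gr M \ Pa).erase x := by
    intro w hw
    rw [← hFx, Finset.mem_sdiff, Finset.mem_insert] at hw
    push Not at hw
    rw [Finset.mem_union, Finset.mem_sdiff, Finset.mem_erase, Finset.mem_sdiff]
    by_cases hwP : w ∈ Pa
    · exact Or.inl ⟨hwP, hw.2.2⟩
    · exact Or.inr ⟨hw.2.1, hw.1, hwP⟩
  have hFx4 : 4 ≤ rkN M Fx := by rw [← hFx, ← crk_eq_rkN]; exact hxd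
  have hPaQ3 : rkN M (Pa \ Q) = 3 := by
    have h1 := rkN_union_le (M := M) (Pa \ Q) ((gr M \ Pa).erase x)
    have h2 : rkN M ((gr M \ Pa).erase x) ≤ 1 := by
      have hx_out' : x ∈ gr M \ Pa := by rw [Finset.mem_sdiff]; exact ⟨hxg, hxPa⟩
      have hFa' : (gr M \ Pa).card = 2 := by rw [← hout_eq]; exact hFa
      have := rkN_le_card (M := M) ((gr M \ Pa).erase x)
      rw [Finset.card_erase_of_mem hx_out', hFa'] at this
      exact this
    have h3 := rkN_mono (M := M) hFxsub
    have h4 : rkN M (Pa \ Q) ≤ 3 := by rw [← hPa3]; exact rkN_mono Finset.sdiff_subset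
    omega
  have hy_cl : y ∈ clF M Fx := by
    have h1 : clF M (Pa \ Q) = Pa := by
      have := clF_eq_clF_of_subset_of_rkN_le (M := M) (Finset.sdiff_subset (s := Pa) (t := Q)) (by rw [hPa3, hPaQ3])
      rw [this, ← hPa, clF_clF]
    have h2 : y ∈ Pa := hQPa hy
    rw [← h1] at h2
    exact clF_mono hFxPa h2
  -- conclude
  have hcrk : crk M (insert x (Q.erase y)) ≤ fB M (insert x (Q.erase y)) := by
    unfold fB outer
    rw [crk_eq_rkN, hclB', hB'E, Finset.sdiff_erase (hQg hy), hFx]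
    exact rkN_le_of_subset_clF (Finset.insert_subset hy_cl (subset_clF_self (by rw [← hFx]; exact Finset.sdiff_subset)))
  unfold jB
  omega

end Staged
end PercRepro
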